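import Mathlib
import Summits.Ventures.PercRepro2.Defs
import Summits.Ventures.PercRepro2.Graph
import Summits.Ventures.PercRepro2.OneColourSwitch
import Summits.Ventures.PercRepro2.RegionHubSign
import Summits.Ventures.PercRepro2.SideSwitch
import Summits.Ventures.PercRepro2.SideSwitchFibre
import Summits.Ventures.PercRepro2.SideSwitchClosed
import Summits.Ventures.PercRepro2.SideSwitchComps
import Summits.Ventures.PercRepro2.SideSwitchCompsFibre
import Summits.Ventures.PercRepro2.TermSwitchDefs
import Summits.Ventures.PercRepro2.TermSwitchFibre
import Summits.Ventures.PercRepro2.TermSwitchCompsFibre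
import Summits.Ventures.PercRepro2.TermSwitchMono
import Summits.Ventures.PercRepro2.TermSwitchM9
import Summits.Ventures.PercRepro2.TermSwitchRestrict
import Summits.Ventures.PercRepro2.TermSwitchReach
import Summits.Ventures.PercRepro2.M9NoPocketDefs
import Summits.Ventures.PercRepro2.M9NoPocketWorld
import Summits.Ventures.PercRepro2.M9NoPocketWorldD
import Summits.Ventures.PercRepro2.M9NoPocketFibre

/-!
# The `G − d` blocks inside a union of `H`-components (blind cell PercRepro2, p3 g38,
2026-08-29; `proofs/P3-POCKETRK.md` §5‴ (b), kernel plan K1–K2, part 1)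

For the terminal set `H = {r, s, d}` and the graph `G − d` (`endsD`): the worlds of `{r, s}`
in `G − d` lie in the worlds of `H` (`U2_endsD_subset_UH`), a sided vertex of `G − d` is sided
for `H` (`mem_A0H_triple_of_mem_A0_endsD`), and two vertices of the `H`-sided set joined by an edge lie
in the same `H`-component (`mem_unionT_of_adj`) — so an `H`-component contains every `G − d`
block it meets: the `G − d` sided vertices of a union `⋃ T` of `H`-components form a set closed
inside the sided set of `G − d` (`closedIn_unionT_inter_A0`), and an edge touching the worlds of
`{r, s}` in `G − d` touches `⋃ T` iff it touches the `G − d` blocks inside it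
(`mem_touches_unionT_iff`).  For a representative of `H` the `W`-side of `G − d` is empty
(`Bside_endsD_eq_empty_of_mem_RepH`) and the normalisation `nu` of `G − d` is the identity
(`nu_endsD_eq_of_mem_RepH`).  Used by `M9PocketUnitSum` (the unit predicate is fibre data).
Own work; std axioms.
-/

namespace Summit.Ventures.PercRepro2

namespace NoPocket

open Finset Classical RegionHub OneColourSwitch SideSwitch TermSwitch

variable {V : Type*} {E : Type*}

section Pointwise

variable {ends : E → Sym2 V} {r s d : V}

/-- An edge touching a set not containing `d` (in `G − d`) is not at `d`. -/
lemma d_notMem_of_mem_touches_endsD {S : Set V} (hd : d ∉ S) {e : E}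
    (he : e ∈ touches (endsD ends d) S) : d ∉ ends e := by
  intro hde
  obtain ⟨x, hx, y, hxy⟩ := he
  rw [endsD_of_mem hde, Sym2.eq_iff] at hxy
  rcases hxy with ⟨h1, _⟩ | ⟨_, h1⟩ <;> exact hd (h1 ▸ hx)

/-- `d` lies in no world of `{r, s}` in `G − d`. -/
lemma d_notMem_U2_endsD (hr : d ≠ r) (hs : d ≠ s) (ω : Config E) :
    d ∉ K2 (endsD ends d) r s ω ∪ M2 (endsD ends d) r s ω := by
  rintro (h | h)
  · exact not_mem_K2_endsD hr hs ω h
  · exact not_mem_M2_endsD hr hs ω h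

/-- An edge touching the worlds of `{r, s}` in `G − d` is not at `d`. -/
lemma d_notMem_of_mem_touches_U2 (hr : d ≠ r) (hs : d ≠ s) {ω : Config E} {e : E}
    (he : e ∈ touches (endsD ends d) (K2 (endsD ends d) r s ω ∪ M2 (endsD ends d) r s ω)) :
    d ∉ ends e :=
  d_notMem_of_mem_touches_endsD (d_notMem_U2_endsD hr hs ω) he

/-- The worlds of `{r, s}` in `G − d` lie in the worlds of the terminal set `{r, s, d}`. -/
lemma U2_endsD_subset_UH (ω : Config E) {x : V}
    (hx : x ∈ K2 (endsD ends d) r s ω ∪ M2 (endsD ends d) r s ω) :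
    x ∈ KH ends ({r, s, d} : Set V) ω ∪ MH ends ({r, s, d} : Set V) ω := by
  rcases hx with hx | hx
  · exact Or.inl (K2_subset_KH (r_mem_triple r s d) (s_mem_triple r s d) ω
      (K2_endsD_subset_K2 ω hx))
  · exact Or.inr (K2_subset_KH (r_mem_triple r s d) (s_mem_triple r s d)
      (OneColourSwitch.compl ω) (M2_endsD_subset_M2 ω hx))

/-- A sided vertex of `G − d` is a sided vertex of the terminal set `{r, s, d}`. -/
lemma mem_A0H_triple_of_mem_A0_endsD [Fintype V] [DecidableEq V] (hr : d ≠ r) (hs : d ≠ s)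
    {ω : Config E} {x : V} (hx : x ∈ A0 (endsD ends d) r s ω) :
    x ∈ A0H ends ({r, s, d} : Set V) ω := by
  obtain ⟨hU, hxr, hxs⟩ := mem_A0.1 hx
  refine mem_A0H.2 ⟨U2_endsD_subset_UH ω hU, ?_⟩
  simp only [Set.mem_insert_iff, Set.mem_singleton_iff, not_or]
  refine ⟨hxr, hxs, ?_⟩
  rintro rfl
  exact d_notMem_U2_endsD hr hs ω hU

/-- Under `Sep` in `G − d`, an edge not at `d` from `r` or `s` ends in the worlds of `{r, s}`. -/
lemma mem_U2_endsD_of_edge_rs {p q : V} {ω : Config E} (hsep : sep2 (endsD ends d) p q r s ω)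
    {e : E} (hde : d ∉ ends e) {x y : V} (hxy : ends e = s(x, y)) (hx : x = r ∨ x = s) :
    y ∈ K2 (endsD ends d) r s ω ∪ M2 (endsD ends d) r s ω := by
  by_contra hy
  have hy' : y ∉ K2 (endsD ends d) r s ω ∧ y ∉ M2 (endsD ends d) r s ω := by
    exact ⟨fun h => hy (Or.inl h), fun h => hy (Or.inr h)⟩
  have hends : endsD ends d e = s(x, y) := by rw [endsD_of_notMem hde, hxy]
  rcases hx with rfl | rfl
  · exact not_edge_r_outside hsep hy'.1 hy'.2 hends
  · exact not_edge_s_outside hsep hy'.1 hy'.2 hends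

end Pointwise

section Fibre

variable [Fintype V] [DecidableEq V] {ends : E → Sym2 V} {p q r s d : V}

/-- For a representative of the terminal set `{r, s, d}`, the `W`-side of `G − d` is empty. -/
lemma Bside_endsD_eq_empty_of_mem_RepH [Fintype E] [DecidableEq E] (hr : d ≠ r) (hs : d ≠ s)
    {ρ : Config E} (hρ : ρ ∈ RepH ends p q ({r, s, d} : Set V)) :
    Bside (endsD ends d) r s ρ = ∅ := by
  rw [Finset.eq_empty_iff_forall_notMem]
  intro x hx
  obtain ⟨hxM, hxr, hxs⟩ := mem_Bside.1 hx
  have hxMH : x ∈ MH ends ({r, s, d} : Set V) ρ :=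
    K2_subset_KH (r_mem_triple r s d) (s_mem_triple r s d) (OneColourSwitch.compl ρ)
      (M2_endsD_subset_M2 ρ hxM)
  have hxH := (mem_RepH.1 hρ).2 x hxMH
  simp only [Set.mem_insert_iff, Set.mem_singleton_iff] at hxH
  rcases hxH with rfl | rfl | rfl
  · exact hxr rfl
  · exact hxs rfl
  · exact not_mem_M2_endsD hr hs ρ hxM

/-- For a representative of `{r, s, d}`, the normalisation of `G − d` is the identity. -/
lemma nu_endsD_eq_of_mem_RepH [Fintype E] [DecidableEq E] (hr : d ≠ r) (hs : d ≠ s)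
    {ρ : Config E} (hρ : ρ ∈ RepH ends p q ({r, s, d} : Set V)) :
    nu (endsD ends d) r s ρ = ρ := by
  unfold nu
  rw [Bside_endsD_eq_empty_of_mem_RepH hr hs hρ]
  funext e
  apply flipTouch_of_notMem
  rintro ⟨x, hx, _, _⟩
  simp at hx

/-- For a representative of `{r, s, d}`, every sided vertex of `G − d` is in the `Y`-world. -/
lemma A0_endsD_subset_K2_of_mem_RepH [Fintype E] [DecidableEq E] (hr : d ≠ r) (hs : d ≠ s)
    {ρ : Config E} (hρ : ρ ∈ RepH ends p q ({r, s, d} : Set V)) {x : V}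
    (hx : x ∈ A0 (endsD ends d) r s ρ) : x ∈ K2 (endsD ends d) r s ρ := by
  obtain ⟨hU, hxr, hxs⟩ := mem_A0.1 hx
  rcases hU with hK | hM
  · exact hK
  · have : x ∈ Bside (endsD ends d) r s ρ := mem_Bside.2 ⟨hM, hxr, hxs⟩
    rw [Bside_endsD_eq_empty_of_mem_RepH hr hs hρ] at this
    simp at this

/-- Two vertices of `A0H` joined by an edge not at `d` lie in the same `H`-component: if one
lies in a union of `H`-components, so does the other. -/
lemma mem_unionT_of_adj {T : Finset (Finset V)} {ρ : Config E}
    (hT : T ⊆ compsH ends ({r, s, d} : Set V) ρ) {x y : V}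
    (hx : x ∈ A0H ends ({r, s, d} : Set V) ρ) (hy : y ∈ A0H ends ({r, s, d} : Set V) ρ)
    {e : E} (hxy : ends e = s(x, y)) (hyT : y ∈ unionT T) : x ∈ unionT T := by
  obtain ⟨C, hC, hyC⟩ := mem_unionT.1 hyT
  refine mem_unionT.2 ⟨C, hC, ?_⟩
  rw [eq_compIn_of_mem_compsH (hT hC) hyC]
  have he : chi ends (↑(A0H ends ({r, s, d} : Set V) ρ) : Set V) e = true :=
    chi_eq_true_iff.2 ⟨y, Finset.mem_coe.2 hy, x, Finset.mem_coe.2 hx, by rw [hxy, Sym2.eq_swap]⟩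
  exact mem_compIn.2 (conn_of_openAdj ⟨e, he, by rw [hxy, Sym2.eq_swap]⟩)

/-- **The blocks inside a union of `H`-components are closed in `G − d`**: the `G − d` sided
vertices of a union of `H`-components form a set closed under adjacency inside the sided set of
`G − d`. -/
lemma closedIn_unionT_inter_A0 (hr : d ≠ r) (hs : d ≠ s) {T : Finset (Finset V)} {ρ : Config E}
    (hT : T ⊆ compsH ends ({r, s, d} : Set V) ρ) :
    ClosedIn (endsD ends d) (sided (endsD ends d) r s ρ)
      (↑(unionT T ∩ A0 (endsD ends d) r s ρ) : Set V) := by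
  intro e x y hends hx hy
  rw [Finset.mem_coe, Finset.mem_inter] at hx
  rw [sided_eq_coe_A0, Finset.mem_coe] at hy
  rw [Finset.mem_coe, Finset.mem_inter]
  refine ⟨?_, hy⟩
  have hxd : x ≠ d := by
    rintro rfl
    exact d_notMem_U2_endsD hr hs ρ (mem_A0.1 hx.2).1
  have hde : d ∉ ends e := by
    intro hde
    rw [endsD_of_mem hde, Sym2.eq_iff] at hends
    rcases hends with ⟨h1, _⟩ | ⟨_, h1⟩ <;> exact hxd h1.symm
  rw [endsD_of_notMem hde] at hends
  exact mem_unionT_of_adj hT (mem_A0H_triple_of_mem_A0_endsD hr hs hy)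
    (mem_A0H_triple_of_mem_A0_endsD hr hs hx.2) (by rw [hends, Sym2.eq_swap]) hx.1

/-- **On the edges touching the worlds of `{r, s}` in `G − d`, the switch of a union of
`H`-components is the switch of the `G − d` blocks inside it.** -/
lemma mem_touches_unionT_iff (hr : d ≠ r) (hs : d ≠ s) {T : Finset (Finset V)} {ρ : Config E}
    (hsep : sep2 (endsD ends d) p q r s ρ)
    (hT : T ⊆ compsH ends ({r, s, d} : Set V) ρ) {e : E}
    (he : e ∈ touches (endsD ends d) (K2 (endsD ends d) r s ρ ∪ M2 (endsD ends d) r s ρ)) :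
    e ∈ touches ends (↑(unionT T) : Set V) ↔
      e ∈ touches ends (↑(unionT T ∩ A0 (endsD ends d) r s ρ) : Set V) := by
  have hde : d ∉ ends e := d_notMem_of_mem_touches_U2 hr hs he
  obtain ⟨x, hxU, y, hxy⟩ := he
  rw [endsD_of_notMem hde] at hxy
  constructor
  · rintro ⟨z, hz, w, hzw⟩
    rw [Finset.mem_coe] at hz
    -- `z` is an endpoint of `e`
    rw [hxy, Sym2.eq_iff] at hzw
    -- the sided vertices of `G − d` reached from the union
    have hkey : ∀ a b : V, ends e = s(a, b) → a ∈ K2 (endsD ends d) r s ρ ∪ M2 (endsD ends d) r s ρ →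
        b ∈ unionT T → e ∈ touches ends (↑(unionT T ∩ A0 (endsD ends d) r s ρ) : Set V) := by
      intro a b hab haU hbT
      by_cases hbA : b ∈ A0 (endsD ends d) r s ρ
      · exact ⟨b, Finset.mem_coe.2 (Finset.mem_inter.2 ⟨hbT, hbA⟩), a,
          by rw [hab, Sym2.eq_swap]⟩
      · -- `b` is not sided in `G − d`: then `a` is not `r, s`, hence sided, and in the union
        have hars : ¬ (a = r ∨ a = s) := by
          intro hars
          have hbU := mem_U2_endsD_of_edge_rs hsep hde hab hars
          have hbH : b ∉ ({r, s, d} : Set V) :=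
            (mem_A0H.1 (unionT_subset_A0H hT hbT)).2
          simp only [Set.mem_insert_iff, Set.mem_singleton_iff, not_or] at hbH
          exact hbA (mem_A0.2 ⟨hbU, hbH.1, hbH.2.1⟩)
        have haA : a ∈ A0 (endsD ends d) r s ρ :=
          mem_A0.2 ⟨haU, fun h => hars (Or.inl h), fun h => hars (Or.inr h)⟩
        have haT : a ∈ unionT T :=
          mem_unionT_of_adj hT (mem_A0H_triple_of_mem_A0_endsD hr hs haA)
            (unionT_subset_A0H hT hbT) hab hbT
        exact ⟨a, Finset.mem_coe.2 (Finset.mem_inter.2 ⟨haT, haA⟩), b, hab⟩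
    rcases hzw with ⟨h1, _⟩ | ⟨_, h2⟩
    · -- `z = x` is an endpoint in the worlds: it is sided (not `r, s`) and in the union
      have hxT : x ∈ unionT T := by rw [h1]; exact hz
      have hxrs : ¬ (x = r ∨ x = s) := by
        intro hxrs
        have hxH : x ∉ ({r, s, d} : Set V) := (mem_A0H.1 (unionT_subset_A0H hT hxT)).2
        simp only [Set.mem_insert_iff, Set.mem_singleton_iff, not_or] at hxH
        rcases hxrs with h | h
        · exact hxH.1 h
        · exact hxH.2.1 h
      have hxA : x ∈ A0 (endsD ends d) r s ρ :=
        mem_A0.2 ⟨hxU, fun h => hxrs (Or.inl h), fun h => hxrs (Or.inr h)⟩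
      exact ⟨x, Finset.mem_coe.2 (Finset.mem_inter.2 ⟨hxT, hxA⟩), y, hxy⟩
    · have hyT : y ∈ unionT T := by rw [h2]; exact hz
      exact hkey x y hxy hxU hyT
  · rintro ⟨z, hz, w, hzw⟩
    exact ⟨z, Finset.mem_coe.2 (Finset.mem_inter.1 (Finset.mem_coe.1 hz)).1, w, hzw⟩

end Fibre

end NoPocket

end Summit.Ventures.PercRepro2
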